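import Summits.BirchSwinnertonDyer.BirchSwinnertonDyer.Theorems.ErratumRoadFiveBdvCalibrationSplitDefs

/-!
# The BDV-calibration split of `A♭-fam` — the finer split of the calibrator atom S2 (Defs II; crux
# stmt-BirchSwinnertonDyer-19715, (α2) item stmt-BirchSwinnertonDyer-33169; deliverable 1 of idea-9 g48, PORTED §3)

`EisensteinPeriodRatioValuation L p ⟸ CalibratorSupply L p ∧ CalibratorDataRealisable ∧ BstwIntegralPerrinRiouGoodOrdinary`
(`eisensteinPeriodRatioValuation_of_supply_of_port`, proved), so that the ER5 aside can be graded piecewise: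

* `CalibratorSupply L p` (S2a) — **conjecture-shaped**: a good-ordinary rank-one big-image curve `E′`, Heegner for the
  PRESCRIBED `L`, with `L(E′^{d_L},1) ≠ 0`, exists (no printed theorem supplies it for a prescribed `L`; BSTW choose
  `L` after `E`, §6.2.1 p. 60);
* `CalibratorDataRealisable` (S2c) — print-shaped: every such curve CARRIES a full value-pinned data tuple of the
  registered frame with `σ ≠ 0` [BSTW24 Thm. 6.4; Kato04 Thm. 12.5; BDP13 Thm. 5.13; Castella18 Thm. 3.2];
* `BstwIntegralPerrinRiouGoodOrdinary` (S2b) — print-shaped PORT of BSTW24 Thm. 1.13 in its §6.2.1-integral form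
  (log-Kato-elt-1) with `u_L ∈ ℤ_(p)^×` ((86)–(94), p. 60), in the LEAD's Kato-family currency: the good-`p` twin of
  `A♭-fam` (the typed-literature gap named in
  `Literature/NumberTheory/EllipticCurves/BurungaleSkinnerTianWan2024/IntroductionTheoremsOPEN.lean`).

Decl texts = workfile `Cruxes/EulerHalfNotRamNoInertSetAtFive/Lines/bdv_calibration_split.lean` (32d3c462f2f9) §3, 1:1;
`@[conjecture]` on the open constants/predicate per cell RULING 75 (OPEN, nothing asserted).  Typed ≠ proved; no summit
statement is touched; BSD is proved for no curve.
-/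

set_option autoImplicit false
-- D-0017: single-problem summit, so `Summit.BirchSwinnertonDyer.BirchSwinnertonDyer.…` repeats a namespace BY DESIGN.
set_option linter.dupNamespace false

noncomputable section

open scoped Classical NumberField TensorProduct BigOperators

namespace Summit.BirchSwinnertonDyer.BirchSwinnertonDyer.Theorems.ErratumRoadFiveBdvCalibrationSplit

open Field
open Literature.NumberTheory.GaloisRepresentations
open Literature.NumberTheory.EllipticCurves Literature.NumberTheory.EllipticCurves.Kato2004
open Literature.NumberTheory.EllipticCurves.Kato2004.EulerSystemValues
open Literature.NumberTheory.EllipticCurves.Rank1Residual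
open Literature.NumberTheory.EllipticCurves.Rank1Residual.Typed
open Literature.NumberTheory.EllipticCurves.ModularForms
open Literature.NumberTheory.EllipticCurves.Castella2018
open Summit.BirchSwinnertonDyer.Rank1Residual
open IsDedekindDomain (HeightOneSpectrum)
open CongruenceSubgroup (Gamma0)

/-! ## §3 The finer split of the calibrator atom — what is SUPPLY (conjecture-shaped) and what is PRINT

`EisensteinPeriodRatioValuation L p ⟸ CalibratorSupply L p ∧ CalibratorDataRealisable ∧ BstwIntegralPerrinRiouGoodOrdinary`
(`eisensteinPeriodRatioValuation_of_supply_of_port`, proved), so that the ER5 aside can be graded piecewise. -/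

/-- **S2a — `CalibratorSupply L p` [conjecture-shaped obligation].**  For the admissible imaginary quadratic `L`
and the prime `p` there is an elliptic curve `E′/ℚ` (globally minimal model) of analytic rank `1`, with `E′[p]`
irreducible and `ρ̄_{E′,p}` surjective, GOOD ORDINARY at `p`, satisfying the Heegner hypothesis for `L` at its
conductor, with `L(E′^{d_L}, 1) ≠ 0`.  No printed theorem supplies it for a PRESCRIBED `L` (road: level-aspect
non-vanishing of `L(E^{d_L},1)` over rank-one curves with prescribed local behaviour at `p` and at the primes of
`d_L`; BSTW choose `L` after `E`, §6.2.1 p. 60, which is the opposite order).  Why it might fail: it should not — it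
is an existence statement about a Zariski-dense-looking family — but it is OPEN as stated.
[cite: BurungaleSkinnerTianWan2024, §6.2.1 «Let L be an imaginary quadratic field satisfying …», p. 60] -/
@[conjecture]
def CalibratorSupply (L : Type) [Field L] [NumberField L] (p : ℕ) [Fact p.Prime] : Prop :=
  ∃ (W : WeierstrassCurve ℚ) (_ : W.IsElliptic) (_ : W.IsGloballyMinimal),
    W.analyticRank = 1 ∧ Irr W p ∧ GoodOrd W p ∧ Surj W p ∧
    SatisfiesHeegnerHypothesis (W.conductorNorm ℤ) L ∧
    (W.quadraticTwist (NumberField.discr L : ℚ)).entireLFunction 1 ≠ 0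

/-- **S2c — `CalibratorDataRealisable` [print-shaped].**  Every good-ordinary rank-one big-image curve that is
Heegner for an admissible `L` (`p ≥ 5`) CARRIES a full data tuple of the registered frame with `σ ≠ 0`: a Heegner
datum and an `L`-rational Heegner point over `heegnerPointComplex` [GrossZagier86 §I.6, V.2], the two descent scalars
[tree `ErratumRoadFiveGrossZagierDescentExact`], a minimal parametrisation in the class of `f`, the cyclotomic
`ℤ_p`-extension with `IwasawaH1Data` and a value-pinned Kato family dominating it [Kato04 Thm 12.5; tree
`Kato2004.AdmissibleZetaClassRealisability`], the period ratio, a BDP frame at the GOOD prime `p`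
[BDP13 Thm 5.13; Castella–Hsieh 2018; tree `castella2018_exists_isBDPLFunction` (semistable case)], its value at the
trivial character, and a Kummer logarithm of the bottom class [tree `exists_hasLocPKummerLog_bottomClass`] which is
NON-ZERO — the last clause is BSTW's Theorem 6.4 (`loc_p z_Kato ≠ 0` at a good ordinary prime of a rank-one curve).
Why it might fail: only through typed-literature gaps (the BDP frame at good `p` is in the tree for square-free `N`).
[cite: BurungaleSkinnerTianWan2024, Thm. 6.4, p. 59] [cite: Kato2004Asterisque, Thm. 12.5, p. 229] -/
@[conjecture]
def CalibratorDataRealisable : Prop :=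
  ∀ (p : ℕ) [Fact p.Prime], 5 ≤ p → ∀ (L : Type) [Field L] [NumberField L], IsImaginaryQuadratic L →
    SatisfiesHeegnerHypothesis p L → NumberField.discr L < -4 → Odd (NumberField.discr L) →
  ∀ (W : WeierstrassCurve ℚ) [W.IsElliptic] [W.IsGloballyMinimal],
    W.analyticRank = 1 → Irr W p → GoodOrd W p → Surj W p →
    SatisfiesHeegnerHypothesis (W.conductorNorm ℤ) L →
    (W.quadraticTwist (NumberField.discr L : ℚ)).entireLFunction 1 ≠ 0 →
  ∃ (_ : ContinuousSMul ℤ_[p] (W.tateModule p)) (_ : Module.Free ℤ_[p] (W.tateModule p))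
    (_ : Module.Finite ℤ_[p] (W.tateModule p)) (_ : NeZero (W.conductorNorm ℤ)),
    ∃ (Dt : ModularParametrizationData W (W.conductorNorm ℤ))
      (Hd : HeegnerDatum (W.conductorNorm ℤ) (NumberField.discr L)) (w₀ : NumberField.InfinitePlace L)
      (PL : (W.baseChange L).toAffine.Point),
      WeierstrassCurve.Affine.Point.map w₀.embedding.toRatAlgHom PL = heegnerPointComplex Dt Hd ∧
      ¬ (p : ℤ) ∣ Dt.c ∧
    ∃ (s : ℚ) (k : ℤ),
      (Real.sqrt ((NumberField.discr L).natAbs : ℝ) : ℂ) *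
          (W.quadraticTwist (NumberField.discr L : ℚ)).entireLFunction 1 = (s : ℂ) * (minusPeriod Dt.f : ℂ) ∧
      (Dt.c : ℝ) * minusPeriod Dt.f = k * W.imaginaryPeriodRat ∧
    ∃ (W' : WeierstrassCurve ℚ) (_ : W'.IsElliptic) (D : ModularParametrizationData W' (W.conductorNorm ℤ)),
      D.f = Dt.f ∧
      (∀ (W'' : WeierstrassCurve ℚ) [W''.IsElliptic] (D'' : ModularParametrizationData W'' (W.conductorNorm ℤ)),
          D''.f = D.f → D.modularDegree ≤ D''.modularDegree) ∧
    ∃ (K : ZpExtension ℚ p) (hK : K.IsCyclotomic) (γ : absoluteGaloisGroup ℚ)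
      (I : IwasawaH1Data W p K γ), K.IsTopGenerator γ ∧
    ∃ (hp : p ≠ 2) (N : ℕ) (_ : NeZero N) (f : CuspForm (Gamma0 N) 2), IsNewformOf W f ∧
    ∃ (ι : (n : ℕ) → (CyclotomicField n ℚ →+* ℂ)) (q : ℚ)
      (Λ : ∀ (m : ℕ) (r : Finset (HeightOneSpectrum (𝓞 ℚ))),
        H1 (tateRep W p) (cycSubgroup p m r) →ₗ[ℤ_[p]] ℚ_[p] ⊗[ℚ] CyclotomicField (cycLevel p m r) ℚ)
      (c d₁ a : ℤ) (A : ℕ) (d' : ℤ)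
      (z : ∀ (m : ℕ) (r : (cyclotomicLevelsRat p (badPlaces c d₁ A N)).Ideals),
        H1 (tateRep W p) ((cyclotomicLevelsRat p (badPlaces c d₁ A N)).level m r.1))
      (x : ∀ (m : ℕ) (r : (cyclotomicLevelsRat p (badPlaces c d₁ A N)).Ideals),
        CyclotomicField (cycLevel p m r.1) ℚ)
      (y : I.H) (perRatio : ℚ),
      q ≠ 0 ∧ ZetaBody W p f ι ((q : ℚ) : ℝ) Λ c d₁ a A z x ∧
      (∀ n : ℕ, I.proj n y =
        levelToLayer W p hK hp (badPlaces c d₁ A N) n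
          (z (n + 1) (cyclotomicLevelsRat p (badPlaces c d₁ A N)).idealOne)) ∧
      0 < A ∧ Int.gcd c (6 * p * A) = 1 ∧ Int.gcd d₁ (6 * p * N) = 1 ∧ (d₁ : ℤ) * d' ≡ 1 [ZMOD (A : ℤ)] ∧
      ratCuspFactor f true c d₁ a A d' ≠ 0 ∧ perRatio ≠ 0 ∧
      plusPeriod f = ((perRatio : ℚ) : ℝ) * W.realPeriodRat ∧
    ∃ (ι' : PadicAlgCl p ≃+* ℂ)
      (κ : ZpExtension L p) (γ' : absoluteGaloisGroup L) (ΩK : ℂ) (Ωp : (unrIntegers p)ˣ) (Λf : UnrSeries p),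
      κ.IsAnticyclotomic ∧ κ.IsTopGenerator γ' ∧ ΩK ≠ 0 ∧
      IsBDPLFunction ι' (X11b.primeOfEmbeddingDatum p ι' w₀.embedding) κ γ' Dt.f ΩK
        ((Ωp : unrIntegers p) : ℂ_[p]) Λf ∧
    ∃ (X : ℂ_[p]), Λf.HasValueAt 0 X ∧
    ∃ σ : ℚ_[p], HasLocPKummerLog W p (bottomClass W p K I y) σ ∧ σ ≠ 0

/-- **S2b — `BstwIntegralPerrinRiouGoodOrdinary` [print-shaped port; the typed-literature gap named in
`Literature/NumberTheory/EllipticCurves/BurungaleSkinnerTianWan2024/IntroductionTheoremsOPEN.lean` (Thm 1.13 not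
typed)].**  For every GOOD ORDINARY rank-one big-image curve (`p ≥ 5`), every admissible `L` and every value-pinned
data tuple of the registered frame, `σ ≠ 0 →` the crossing norm identity holds with the explicit exponent
`bdvExplicitExponent …` EXACTLY: Burungale–Skinner–Tian–Wan's integral Perrin-Riou formula (log-Kato-elt-1) with
`u_L ∈ ℤ_(p)^×` ((86)–(94)) and `c(ω,γ,γ′) ∈ O^×` (Prop. 4.13 (ii)), crossed with the BDP value formula at a good prime
(`(1 − a_p/p + 1/p)²`, `bdpInterpolationValue` with `ε_p = p⁻¹`) and the Gross–Zagier descent, in the LEAD's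
Kato-family currency (rows 1–2 as on the door).  It is the good-`p` twin of `A♭-fam`.  Why it might fail: the ONE
transcription risk flagged in the module docstring (`Γ₀` vs a `p`-stabilised congruence number at good `p`).
[cite: BurungaleSkinnerTianWan2024, Thm. 1.13, Prop. 4.13, §6.2.1 (86)–(94), p. 43, 59–60]
[cite: Kato2004Asterisque, Thm. 12.5 (1), p. 229] -/
@[conjecture]
def BstwIntegralPerrinRiouGoodOrdinary : Prop :=
  ∀ (W : WeierstrassCurve ℚ) [W.IsElliptic] [W.IsGloballyMinimal] (p : ℕ) [Fact p.Prime]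
    [ContinuousSMul ℤ_[p] (W.tateModule p)] [Module.Free ℤ_[p] (W.tateModule p)]
    [Module.Finite ℤ_[p] (W.tateModule p)] [NeZero (W.conductorNorm ℤ)],
    W.analyticRank = 1 → Irr W p → GoodOrd W p → 5 ≤ p → Surj W p →
    ∀ (L : Type) [Field L] [NumberField L], IsImaginaryQuadratic L →
      SatisfiesHeegnerHypothesis (W.conductorNorm ℤ) L → SatisfiesHeegnerHypothesis p L →
      NumberField.discr L < -4 → Odd (NumberField.discr L) →
      (W.quadraticTwist (NumberField.discr L : ℚ)).entireLFunction 1 ≠ 0 →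
      ∀ (Dt : ModularParametrizationData W (W.conductorNorm ℤ))
        (Hd : HeegnerDatum (W.conductorNorm ℤ) (NumberField.discr L)) (w₀ : NumberField.InfinitePlace L)
        (PL : (W.baseChange L).toAffine.Point),
        WeierstrassCurve.Affine.Point.map w₀.embedding.toRatAlgHom PL = heegnerPointComplex Dt Hd →
        ¬ (p : ℤ) ∣ Dt.c →
      ∀ (s : ℚ) (k : ℤ),
        (Real.sqrt ((NumberField.discr L).natAbs : ℝ) : ℂ) *
            (W.quadraticTwist (NumberField.discr L : ℚ)).entireLFunction 1 = (s : ℂ) * (minusPeriod Dt.f : ℂ) →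
        (Dt.c : ℝ) * minusPeriod Dt.f = k * W.imaginaryPeriodRat →
      ∀ (W' : WeierstrassCurve ℚ) [W'.IsElliptic] (D : ModularParametrizationData W' (W.conductorNorm ℤ)),
        D.f = Dt.f →
        (∀ (W'' : WeierstrassCurve ℚ) [W''.IsElliptic] (D'' : ModularParametrizationData W'' (W.conductorNorm ℤ)),
            D''.f = D.f → D.modularDegree ≤ D''.modularDegree) →
      ∀ (K : ZpExtension ℚ p) (hK : K.IsCyclotomic) (γ : absoluteGaloisGroup ℚ)
        (I : IwasawaH1Data W p K γ), K.IsTopGenerator γ →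
      ∀ (hp : p ≠ 2) (N : ℕ) [NeZero N] (f : CuspForm (Gamma0 N) 2), IsNewformOf W f →
      ∀ (ι : (n : ℕ) → (CyclotomicField n ℚ →+* ℂ)) (q : ℚ)
        (Λ : ∀ (m : ℕ) (r : Finset (HeightOneSpectrum (𝓞 ℚ))),
          H1 (tateRep W p) (cycSubgroup p m r) →ₗ[ℤ_[p]] ℚ_[p] ⊗[ℚ] CyclotomicField (cycLevel p m r) ℚ)
        (c d₁ a : ℤ) (A : ℕ) (d' : ℤ)
        (z : ∀ (m : ℕ) (r : (cyclotomicLevelsRat p (badPlaces c d₁ A N)).Ideals),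
          H1 (tateRep W p) ((cyclotomicLevelsRat p (badPlaces c d₁ A N)).level m r.1))
        (x : ∀ (m : ℕ) (r : (cyclotomicLevelsRat p (badPlaces c d₁ A N)).Ideals),
          CyclotomicField (cycLevel p m r.1) ℚ)
        (y : I.H) (perRatio : ℚ),
        q ≠ 0 → ZetaBody W p f ι ((q : ℚ) : ℝ) Λ c d₁ a A z x →
        (∀ n : ℕ, I.proj n y =
          levelToLayer W p hK hp (badPlaces c d₁ A N) n
            (z (n + 1) (cyclotomicLevelsRat p (badPlaces c d₁ A N)).idealOne)) →
        0 < A → Int.gcd c (6 * p * A) = 1 → Int.gcd d₁ (6 * p * N) = 1 → (d₁ : ℤ) * d' ≡ 1 [ZMOD (A : ℤ)] →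
        ratCuspFactor f true c d₁ a A d' ≠ 0 → perRatio ≠ 0 →
        plusPeriod f = ((perRatio : ℚ) : ℝ) * W.realPeriodRat →
      ∀ (ι' : PadicAlgCl p ≃+* ℂ)
        (κ : ZpExtension L p) (γ' : absoluteGaloisGroup L) (ΩK : ℂ) (Ωp : (unrIntegers p)ˣ) (Λf : UnrSeries p),
        κ.IsAnticyclotomic → κ.IsTopGenerator γ' → ΩK ≠ 0 →
        IsBDPLFunction ι' (X11b.primeOfEmbeddingDatum p ι' w₀.embedding) κ γ' Dt.f ΩK
          ((Ωp : unrIntegers p) : ℂ_[p]) Λf →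
      ∀ (X : ℂ_[p]), Λf.HasValueAt 0 X →
      ∀ σ : ℚ_[p], HasLocPKummerLog W p (bottomClass W p K I y) σ → σ ≠ 0 →
        ‖X‖ = (p : ℝ) ^ (bdvExplicitExponent p (W.LFunction p) Dt.c s k (congruenceNumber Dt.f) D.modularDegree
            (σ.valuation + padicValRat p (perRatio /
              (q * ratCuspFactor f true c d₁ a A d' * ∏ ℓ ∈ A.primeFactors.erase p, eulerFactorAtOne W N ℓ))))

/-- Recomposition of the calibrator atom from its three pieces (proved). -/
theorem eisensteinPeriodRatioValuation_of_supply_of_port (p : ℕ) [Fact p.Prime] (h5 : 5 ≤ p) (L : Type)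
    [Field L] [NumberField L] (hLq : IsImaginaryQuadratic L) (hHp : SatisfiesHeegnerHypothesis p L)
    (hd4 : NumberField.discr L < -4) (hodd : Odd (NumberField.discr L)) (hsup : CalibratorSupply L p)
    (hreal : CalibratorDataRealisable) (hport : BstwIntegralPerrinRiouGoodOrdinary) :
    EisensteinPeriodRatioValuation L p := by
  obtain ⟨W, hE, hGM, hrk, hirr, hgo, hS, hH, hLt⟩ := hsup
  obtain ⟨hCS, hMF, hMFi, hNZ, Dt, Hd, w₀, PL, hPL, hc, s, k, hs, hk, W', hE', D, hDf, hmin, K, hK, γ, I, hγ, hp,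
    N, hN, f, hf, ι, q, Λ, c, d₁, a, A, d', z, x, y, perRatio, hq, hzeta, hy, hA, hcg, hd, hdd, hR, hper0, hper,
    ι', κ, γ', ΩK, Ωp, Λf, hκ, hγ', hΩK, hBDP, X, hXv, σ, hσ, hσ0⟩ :=
    hreal p h5 L hLq hHp hd4 hodd W hrk hirr hgo hS hH hLt
  exact ⟨W, hE, hGM, hCS, hMF, hMFi, hNZ, hrk, hirr, hgo, hS, hH, hLt, Dt, Hd, w₀, PL, hPL, hc, s, k, hs, hk, W',
    hE', D, hDf, hmin, K, hK, γ, I, hγ, hp, N, hN, f, hf, ι, q, Λ, c, d₁, a, A, d', z, x, y, perRatio, hq, hzeta,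
    hy, hA, hcg, hd, hdd, hR, hper0, hper, ι', κ, γ', ΩK, Ωp, Λf, hκ, hγ', hΩK, hBDP, X, hXv, σ, hσ, hσ0,
    hport W p hrk hirr hgo h5 hS L hLq hH hHp hd4 hodd hLt Dt Hd w₀ PL hPL hc s k hs hk W' D hDf hmin K hK γ I hγ
      hp N f hf ι q Λ c d₁ a A d' z x y perRatio hq hzeta hy hA hcg hd hdd hR hper0 hper ι' κ γ' ΩK Ωp Λf hκ hγ'
      hΩK hBDP X hXv σ hσ hσ0⟩

end Summit.BirchSwinnertonDyer.BirchSwinnertonDyer.Theorems.ErratumRoadFiveBdvCalibrationSplit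

end
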